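import Literature.AlgebraicGeometry.Motives.HodgeThetaSubalgebraUnitaryInvertiblePencil
import Literature.AlgebraicGeometry.Motives.HodgeThetaSubalgebraUnitaryFifteenTwentyTwoReduction
import HarnessLib

/-!
# The slot identity at a raising operator of minimal rank: `Y X† B + B X† Y = λ · B`

Family `hodge`, layer `Literature/AlgebraicGeometry/Motives` (pure linear algebra over `ℂ`; no geometry). Research
context: cell `pub-hodge-ring2` (HONEST FRAMING: research route conditional on HC_CM; not a corollary; Q11.4-sentence-2
already refuted in dim ≥ 3), Literature lane gen 87 — step 2 of the proof plan for the last `p = 37` cell `(15 | 22)`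
of Ribet's theorem (`HodgeThetaSubalgebraUnitaryFifteenTwentyTwoReduction`; plan in the gen-87 README). UNCONDITIONAL;
theorems only, no definition, no named fact (D-0026), no `sorry`.

THE IDENTITY. `𝔊` bracket-closed, adjoint-closed for Hermitian data, `Θ ∈ 𝔊` an involution, `B ∈ 𝔊` raising of MINIMAL
non-zero rank `m` with adjoint `C` and involution `ι = ι_B` (so `Q ∩ U⁺` and `B(W)` both have dimension `m`). For
raising `X, Y ∈ 𝔊` commuting with `ι`, with adjoints `X†, Y†`: the operator `L = C X Y† + Y† X C = [Y†, [X, C]]` lies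
in `𝔊`, so does its adjoint `M = Y X† B + B X† Y`; `M` is raising, kills `P` and `Q ∩ ker B`, and maps `Q ∩ U⁺` into
`B(W)`; every `M − c B` is then a raising element of `𝔊` of rank `≤ m`, hence (minimality) zero or injective on
`Q ∩ U⁺`, and the invertible-pencil lemma gives **`Y X† B + B X† Y = λ · B`**.
[cite: GoodmanWallachGTM255, §4.1.1] [cite: Deligne1982HodgeCycles, I §3 Prop. 3.4, 3.6]
[cite: HoffmanKunze1971LinearAlgebra, §8.5, §6.2]

## References
* [GoodmanWallachGTM255] R. Goodman, N. R. Wallach, GTM 255 (2009), §4.1.1.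
* [Deligne1982HodgeCycles] P. Deligne, *Hodge cycles on abelian varieties*, LNM 900 (1982), I §3 Prop. 3.4, 3.6.
* [HoffmanKunze1971LinearAlgebra] K. Hoffman, R. Kunze, *Linear Algebra* (1971), §8.5 (adjoints), §6.2.
-/

noncomputable section

open Module

namespace Literature.AlgebraicGeometry.Motives

namespace HodgeStructure

universe u

variable {W : Type u} [AddCommGroup W] [Module ℂ W]

/-- The adjoint of a raising operator commuting with the (self-adjoint) involution `ι` is a lowering operator
commuting with `ι`, and the adjoint relation can be read in both directions.
[cite: HoffmanKunze1971LinearAlgebra, §8.5] -/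
theorem UnitaryLeviSetup.adj_raise {Θ : Module.End ℂ W} (hΘΘ : Θ * Θ = 1)
    {P Q : Submodule ℂ W} (hP : ∀ x, x ∈ P ↔ Θ x = x) (hQ : ∀ x, x ∈ Q ↔ Θ x = -x)
    {s : W → W → ℂ} (hadd : ∀ x y z, s (x + y) z = s x z + s y z) (hsymm : ∀ x y, s y x = starRingEnd ℂ (s x y))
    (hPQ : ∀ p ∈ P, ∀ q ∈ Q, s p q = 0) (hdefP : ∀ p ∈ P, s p p = 0 → p = 0) (hdefQ : ∀ q ∈ Q, s q q = 0 → q = 0)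
    {ι : Module.End ℂ W} (hιs : ∀ x y, s (ι x) y = s x (ι y))
    {X Xa : Module.End ℂ W} (hΘX : Θ * X = X) (hXΘ : X * Θ = -X) (hXc : X * ι = ι * X)
    (hXXa : ∀ x y, s (X x) y = s x (Xa y)) :
    Θ * Xa = -Xa ∧ Xa * Θ = Xa ∧ Xa * ι = ι * Xa ∧ (∀ x y, s (Xa x) y = s x (X y)) := by
  obtain ⟨hΘXa, hXaΘ⟩ := UnitaryTwoOdd.lower_of_adjoint hadd hsymm hΘΘ hP hQ hPQ hdefP hdefQ hΘX hXΘ hXXa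
  obtain ⟨-, -, -, -, -, hsubr, -⟩ := UnitaryTwoOdd.herm_right hadd hsymm
  have hnd := fun y => UnitaryTwoOdd.eq_zero_of_forall_left hadd hsymm hΘΘ hP hQ hPQ hdefP hdefQ (y := y)
  have hXaX : ∀ x y, s (Xa x) y = s x (X y) := fun x y => by
    rw [hsymm, ← hXXa, ← hsymm]
  refine ⟨hΘXa, hXaΘ, ?_, hXaX⟩
  refine LinearMap.ext fun y => ?_
  rw [← sub_eq_zero, ← LinearMap.sub_apply]
  refine hnd _ fun x => ?_
  rw [LinearMap.sub_apply, hsubr, Module.End.mul_apply, Module.End.mul_apply, ← hXXa, ← hιs, ← hιs, ← hXXa,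
    ← Module.End.mul_apply, ← Module.End.mul_apply, hXc, sub_self]

/-- **The slot identity.** At a raising `B ∈ 𝔊` of minimal non-zero rank (adjoint `C`, involution `ι`), for raising
`X, Y ∈ 𝔊` commuting with `ι` and adjoints `X†, Y† ∈ 𝔊`: `Y X† B + B X† Y = λ · B` for some `λ : ℂ`.
[cite: GoodmanWallachGTM255, §4.1.1] [cite: Deligne1982HodgeCycles, I §3 Prop. 3.4, 3.6]
[cite: HoffmanKunze1971LinearAlgebra, §8.5, §6.2 Thm. 1] -/
theorem UnitaryLeviSetup.slot_identity [FiniteDimensional ℂ W] {𝔊 : Submodule ℂ (Module.End ℂ W)}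
    (hbr : ∀ Y ∈ 𝔊, ∀ Z ∈ 𝔊, Y * Z - Z * Y ∈ 𝔊) {Θ : Module.End ℂ W} (hΘΘ : Θ * Θ = 1)
    {P Q : Submodule ℂ W} (hP : ∀ x, x ∈ P ↔ Θ x = x) (hQ : ∀ x, x ∈ Q ↔ Θ x = -x)
    {s : W → W → ℂ} (hadd : ∀ x y z, s (x + y) z = s x z + s y z) (hsymm : ∀ x y, s y x = starRingEnd ℂ (s x y))
    (hPQ : ∀ p ∈ P, ∀ q ∈ Q, s p q = 0) (hdefP : ∀ p ∈ P, s p p = 0 → p = 0) (hdefQ : ∀ q ∈ Q, s q q = 0 → q = 0)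
    (hadj : ∀ X ∈ 𝔊, ∃ Y ∈ 𝔊, ∀ x y, s (X x) y = s x (Y y))
    {B : Module.End ℂ W} (hΘB : Θ * B = B) (hBΘ : B * Θ = -B) (hB0 : B ≠ 0)
    (hmin : ∀ Z ∈ 𝔊, Θ * Z = Z → Z * Θ = -Z → Z ≠ 0 →
      Module.finrank ℂ (LinearMap.range B) ≤ Module.finrank ℂ (LinearMap.range Z))
    {C : Module.End ℂ W} (hC : C ∈ 𝔊) (hBC : ∀ x y, s (B x) y = s x (C y))
    {ι : Module.End ℂ W} {QU : Submodule ℂ W} (hιι : ι * ι = 1) (hιΘ : ι * Θ = Θ * ι)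
    (hιs : ∀ x y, s (ι x) y = s x (ι y))
    (hPM : ∀ x, x ∈ LinearMap.range B ↔ ι x = -x ∧ Θ x = x)
    (hQM : ∀ x, x ∈ Q ⊓ LinearMap.ker B ↔ ι x = -x ∧ Θ x = -x) (hQU : ∀ x, x ∈ QU ↔ ι x = x ∧ Θ x = -x)
    (hfinQU : Module.finrank ℂ QU = Module.finrank ℂ (LinearMap.range B))
    {X Xa Y Ya : Module.End ℂ W} (hX : X ∈ 𝔊) (hΘX : Θ * X = X) (hXΘ : X * Θ = -X) (hXc : X * ι = ι * X)
    (hXXa : ∀ x y, s (X x) y = s x (Xa y))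
    (hΘY : Θ * Y = Y) (hYΘ : Y * Θ = -Y) (hYc : Y * ι = ι * Y)
    (hYa : Ya ∈ 𝔊) (hYYa : ∀ x y, s (Y x) y = s x (Ya y)) :
    ∃ c : ℂ, Y * Xa * B + B * Xa * Y = c • B := by
  classical
  obtain ⟨haddr, h0r, h0l, hnegr, hnegl, hsubr, hsubl⟩ := UnitaryTwoOdd.herm_right hadd hsymm
  have hnd := fun y => UnitaryTwoOdd.eq_zero_of_forall_left hadd hsymm hΘΘ hP hQ hPQ hdefP hdefQ (y := y)
  have hΘΘv : ∀ v, Θ (Θ v) = v := fun v => by rw [← Module.End.mul_apply, hΘΘ, Module.End.one_apply]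
  have hιιv : ∀ v, ι (ι v) = v := fun v => by rw [← Module.End.mul_apply, hιι, Module.End.one_apply]
  have hΘι : ∀ v, Θ (ι v) = ι (Θ v) := fun v => by rw [← Module.End.mul_apply, ← hιΘ, Module.End.mul_apply]
  obtain ⟨hΘXa, hXaΘ, hXac, hXaX⟩ := UnitaryLeviSetup.adj_raise hΘΘ hP hQ hadd hsymm hPQ hdefP hdefQ hιs hΘX hXΘ hXc hXXa
  obtain ⟨hΘYa, hYaΘ, -, hYaY⟩ := UnitaryLeviSetup.adj_raise hΘΘ hP hQ hadd hsymm hPQ hdefP hdefQ hιs hΘY hYΘ hYc hYYa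
  obtain ⟨hΘC, hCΘ⟩ := UnitaryTwoOdd.lower_of_adjoint hadd hsymm hΘΘ hP hQ hPQ hdefP hdefQ hΘB hBΘ hBC
  have hCB : ∀ x y, s (C x) y = s x (B y) := fun x y => by rw [hsymm, ← hBC, ← hsymm]
  -- raising kills `P`, lowering kills `Q` (as operator identities)
  have hkill : ∀ {S T : Module.End ℂ W}, S * Θ = S → Θ * T = -T → S * T = 0 := by
    intro S T hS hT
    have h : S * T = -(S * T) := by
      calc S * T = S * Θ * T := by rw [hS]
        _ = S * (Θ * T) := by rw [mul_assoc]
        _ = -(S * T) := by rw [hT, mul_neg]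
    have h2 : (2 : ℂ) • (S * T) = 0 := by rw [two_smul]; nth_rewrite 2 [h]; rw [add_neg_cancel]
    exact (smul_eq_zero.1 h2).resolve_left two_ne_zero
  have hkill' : ∀ {S T : Module.End ℂ W}, S * Θ = -S → Θ * T = T → S * T = 0 := by
    intro S T hS hT
    have h : S * T = -(S * T) := by
      calc S * T = S * (Θ * T) := by rw [hT]
        _ = S * Θ * T := by rw [mul_assoc]
        _ = -(S * T) := by rw [hS, neg_mul]
    have h2 : (2 : ℂ) • (S * T) = 0 := by rw [two_smul]; nth_rewrite 2 [h]; rw [add_neg_cancel]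
    exact (smul_eq_zero.1 h2).resolve_left two_ne_zero
  have hYaC : Ya * C = 0 := hkill hYaΘ hΘC
  have hCYa : C * Ya = 0 := hkill hCΘ hΘYa
  -- `L = C X Y† + Y† X C ∈ 𝔊`
  set L : Module.End ℂ W := C * X * Ya + Ya * X * C with hL
  have hT : X * C - C * X ∈ 𝔊 := hbr X hX C hC
  have hLmem : L ∈ 𝔊 := by
    have h := hbr Ya hYa _ hT
    have hcalc : Ya * (X * C - C * X) - (X * C - C * X) * Ya = L := by
      rw [hL, mul_sub, sub_mul, ← mul_assoc Ya C X, hYaC, zero_mul, sub_zero, mul_assoc X C Ya, hCYa, mul_zero,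
        zero_sub, sub_neg_eq_add, ← mul_assoc Ya X C, add_comm]
    rwa [hcalc] at h
  -- `M = Y X† B + B X† Y` is the adjoint of `L`, hence in `𝔊`
  set M : Module.End ℂ W := Y * Xa * B + B * Xa * Y with hM
  have hLM : ∀ x y, s (L x) y = s x (M y) := by
    intro x y
    rw [hL, hM, LinearMap.add_apply, LinearMap.add_apply, hadd, haddr]
    simp only [Module.End.mul_apply]
    rw [hCB, hXXa, hYaY, hYaY, hXXa, hCB]
  obtain ⟨L', hL', hLL'⟩ := hadj L hLmem
  have hL'M : L' = M := by
    refine LinearMap.ext fun y => ?_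
    rw [← sub_eq_zero]
    refine hnd _ fun x => ?_
    rw [hsubr, ← hLL', hLM, sub_self]
  have hMmem : M ∈ 𝔊 := hL'M ▸ hL'
  -- `M` is raising, kills `P` and `Q ∩ ker B`, and maps `Q ∩ U⁺` into `B(W)`
  have hΘM : Θ * M = M := by
    rw [hM, mul_add, ← mul_assoc, ← mul_assoc, hΘY, ← mul_assoc, ← mul_assoc, hΘB]
  have hMΘ : M * Θ = -M := by
    rw [hM, add_mul, mul_assoc (Y * Xa) B Θ, hBΘ, mul_neg, mul_assoc (B * Xa) Y Θ, hYΘ, mul_neg, neg_add]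
  have hBP : ∀ p, Θ p = p → B p = 0 := fun p hp => by
    have h : B p = -(B p) := by
      conv_lhs => rw [← hp, ← Module.End.mul_apply, hBΘ, LinearMap.neg_apply]
    have h2 : (2 : ℂ) • B p = 0 := by rw [two_smul]; nth_rewrite 2 [h]; rw [add_neg_cancel]
    exact (smul_eq_zero.1 h2).resolve_left two_ne_zero
  have hraiseP : ∀ {Z : Module.End ℂ W}, Z * Θ = -Z → ∀ p, Θ p = p → Z p = 0 := by
    intro Z hZ p hp
    have h : Z p = -(Z p) := by
      conv_lhs => rw [← hp, ← Module.End.mul_apply, hZ, LinearMap.neg_apply]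
    have h2 : (2 : ℂ) • Z p = 0 := by rw [two_smul]; nth_rewrite 2 [h]; rw [add_neg_cancel]
    exact (smul_eq_zero.1 h2).resolve_left two_ne_zero
  have hXaι : ∀ v, Xa (ι v) = ι (Xa v) := fun v => by rw [← Module.End.mul_apply, hXac, Module.End.mul_apply]
  have hYι : ∀ v, Y (ι v) = ι (Y v) := fun v => by rw [← Module.End.mul_apply, hYc, Module.End.mul_apply]
  have hΘXav : ∀ v, Θ (Xa v) = -(Xa v) := fun v => by rw [← Module.End.mul_apply, hΘXa, LinearMap.neg_apply]
  have hΘYv : ∀ v, Θ (Y v) = Y v := fun v => by rw [← Module.End.mul_apply, hΘY]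
  -- `Y X† (range B) ⊆ range B` and `B X† Y (Q ∩ ker B) = 0`
  have hYXaP : ∀ p ∈ LinearMap.range B, Y (Xa p) ∈ LinearMap.range B := by
    intro p hp
    obtain ⟨hιp, -⟩ := (hPM p).1 hp
    exact (hPM _).2 ⟨by rw [← hYι, ← hXaι, hιp, map_neg, map_neg], hΘYv _⟩
  have hMQm : ∀ q ∈ Q ⊓ LinearMap.ker B, M q = 0 := by
    intro q hq
    obtain ⟨hιq, hΘq⟩ := (hQM q).1 hq
    have hBq : B q = 0 := LinearMap.mem_ker.1 (Submodule.mem_inf.1 hq).2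
    have hYq : Y q ∈ LinearMap.range B := (hPM _).2 ⟨by rw [← hYι, hιq, map_neg], hΘYv q⟩
    obtain ⟨hιYq, -⟩ := (hPM _).1 hYq
    have hXaYq : Xa (Y q) ∈ Q ⊓ LinearMap.ker B :=
      (hQM _).2 ⟨by rw [← hXaι, hιYq, map_neg], hΘXav _⟩
    have hBXaYq : B (Xa (Y q)) = 0 := LinearMap.mem_ker.1 (Submodule.mem_inf.1 hXaYq).2
    rw [hM, LinearMap.add_apply, Module.End.mul_apply, Module.End.mul_apply, hBq, map_zero, map_zero, zero_add,
      Module.End.mul_apply, Module.End.mul_apply, hBXaYq]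
  have hMQU : QU.map M ≤ LinearMap.range B := by
    rintro _ ⟨v, hv, rfl⟩
    rw [hM, LinearMap.add_apply, Module.End.mul_apply, Module.End.mul_apply, Module.End.mul_apply,
      Module.End.mul_apply]
    exact Submodule.add_mem _ (hYXaP _ (LinearMap.mem_range_self B v)) (LinearMap.mem_range_self B _)
  -- decomposition `w = p + q⁺ + q⁻`
  have hdec : ∀ w, ∃ p qU qm, Θ p = p ∧ qU ∈ QU ∧ qm ∈ Q ⊓ LinearMap.ker B ∧ w = p + qU + qm := by
    intro w
    refine ⟨(2 : ℂ)⁻¹ • (w + Θ w), (4 : ℂ)⁻¹ • ((w - Θ w) + ι (w - Θ w)), (4 : ℂ)⁻¹ • ((w - Θ w) - ι (w - Θ w)),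
      ?_, ?_, ?_, ?_⟩
    · rw [map_smul, map_add, hΘΘv, add_comm]
    · refine (hQU _).2 ⟨?_, ?_⟩
      · rw [map_smul, map_add, hιιv, add_comm]
      · rw [map_smul, map_add, map_sub, hΘΘv, hΘι, map_sub, hΘΘv, ← smul_neg, neg_add, neg_sub, ← map_neg, neg_sub]
    · refine (hQM _).2 ⟨?_, ?_⟩
      · rw [map_smul, map_sub, hιιv, ← smul_neg, neg_sub]
      · rw [map_smul, map_sub, map_sub, hΘΘv, hΘι, map_sub, hΘΘv, ← smul_neg, neg_sub, ← neg_sub (Θ w) w, map_neg,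
          sub_neg_eq_add, neg_add_eq_sub]
    · module
  -- every pencil member `M - c • B` is a raising element of `𝔊`, zero or injective on `Q ∩ U⁺`
  have hrank_le : ∀ Z : Module.End ℂ W, Z * Θ = -Z → (∀ q ∈ Q ⊓ LinearMap.ker B, Z q = 0) →
      LinearMap.range Z = QU.map Z := by
    intro Z hZΘ hZm
    refine le_antisymm ?_ (LinearMap.map_le_range)
    rintro _ ⟨w, rfl⟩
    obtain ⟨p, qU, qm, hp, hqU, hqm, hw⟩ := hdec w
    rw [hw, map_add, map_add, hraiseP hZΘ p hp, zero_add, hZm qm hqm, add_zero]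
    exact Submodule.mem_map_of_mem hqU
  have hS : ∀ c : ℂ, (∀ a ∈ QU, (M - c • B) a = 0) ∨ (∀ a ∈ QU, (M - c • B) a = 0 → a = 0) := by
    intro c
    set Z := M - c • B with hZ
    have hZmem : Z ∈ 𝔊 := Submodule.sub_mem _ hMmem (Submodule.smul_mem _ c (by
      -- `B ∈ 𝔊`: it is the adjoint slot generator; obtain from `hmin`'s context via `C`'s adjoint? we use `hadj C`
      -- instead we note `B` occurs in `𝔊` through `hPM`; supply membership via the adjoint of `C`
      obtain ⟨B', hB', hCB'⟩ := hadj C hC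
      have : B' = B := by
        refine LinearMap.ext fun y => ?_
        rw [← sub_eq_zero]
        refine hnd _ fun x => ?_
        rw [hsubr, ← hCB', hCB, sub_self]
      exact this ▸ hB'))
    have hZΘ : Z * Θ = -Z := by rw [hZ, sub_mul, hMΘ, smul_mul_assoc, hBΘ, smul_neg, neg_sub', sub_neg_eq_add]
    have hΘZ : Θ * Z = Z := by rw [hZ, mul_sub, hΘM, mul_smul_comm, hΘB]
    have hZm : ∀ q ∈ Q ⊓ LinearMap.ker B, Z q = 0 := fun q hq => by
      rw [hZ, LinearMap.sub_apply, LinearMap.smul_apply, hMQm q hq,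
        LinearMap.mem_ker.1 (Submodule.mem_inf.1 hq).2, smul_zero, sub_zero]
    by_cases hZ0 : Z = 0
    · exact Or.inl fun a _ => by rw [hZ0, LinearMap.zero_apply]
    · right
      have hle := hmin Z hZmem hΘZ hZΘ hZ0
      have hrg := hrank_le Z hZΘ hZm
      rw [hrg] at hle
      -- `finrank (QU.map Z) ≥ finrank QU` forces injectivity on `QU`
      have hker := LinearMap.finrank_range_add_finrank_ker (Z.domRestrict QU)
      rw [LinearMap.range_domRestrict] at hker
      have hk0 : Module.finrank ℂ (LinearMap.ker (Z.domRestrict QU)) = 0 := by omega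
      intro a ha hZa
      have hmem : (⟨a, ha⟩ : QU) ∈ LinearMap.ker (Z.domRestrict QU) := by
        rw [LinearMap.mem_ker, LinearMap.domRestrict_apply]; exact hZa
      rw [Submodule.finrank_eq_zero.1 hk0, Submodule.mem_bot] at hmem
      exact congrArg Subtype.val hmem
  have hBinj : ∀ a ∈ QU, B a = 0 → a = 0 := by
    intro a ha hBa
    obtain ⟨hιa, hΘa⟩ := (hQU a).1 ha
    have hmem : a ∈ Q ⊓ LinearMap.ker B := Submodule.mem_inf.2 ⟨(hQ a).2 hΘa, LinearMap.mem_ker.2 hBa⟩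
    obtain ⟨hιa', -⟩ := (hQM a).1 hmem
    rw [hιa] at hιa'
    have h2 : (2 : ℂ) • a = 0 := by rw [two_smul]; nth_rewrite 2 [hιa']; rw [add_neg_cancel]
    exact (smul_eq_zero.1 h2).resolve_left two_ne_zero
  have hQUB : QU.map B = LinearMap.range B := by
    refine Submodule.eq_of_le_of_finrank_eq LinearMap.map_le_range ?_
    have hker := LinearMap.finrank_range_add_finrank_ker (B.domRestrict QU)
    rw [LinearMap.range_domRestrict] at hker
    have hk0 : LinearMap.ker (B.domRestrict QU) = ⊥ := by
      refine (Submodule.eq_bot_iff _).2 fun v hv => ?_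
      rw [LinearMap.mem_ker, LinearMap.domRestrict_apply] at hv
      exact Subtype.ext (hBinj _ v.2 hv)
    rw [hk0, finrank_bot, add_zero] at hker
    rw [hker, hfinQU]
  have hQU0 : QU ≠ ⊥ := by
    intro h
    have h0 : Module.finrank ℂ (LinearMap.range B) = 0 := by rw [← hfinQU, h, finrank_bot]
    exact hB0 (LinearMap.range_eq_bot.1 (Submodule.finrank_eq_zero.1 h0))
  obtain ⟨c, hc⟩ := UnitaryInvertiblePencil.exists_eq_smul_on hQU0 hBinj (hQUB ▸ hMQU) hS
  refine ⟨c, LinearMap.ext fun w => ?_⟩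
  obtain ⟨p, qU, qm, hp, hqU, hqm, hw⟩ := hdec w
  rw [hw, LinearMap.smul_apply, map_add, map_add, map_add, map_add, hraiseP hMΘ p hp, hBP p hp,
    hMQm qm hqm, LinearMap.mem_ker.1 (Submodule.mem_inf.1 hqm).2, hc qU hqU]
  simp only [zero_add, add_zero]

end HodgeStructure

end Literature.AlgebraicGeometry.Motives

end
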